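import Mathlib
import HarnessLib
import Literature.MathematicalPhysics.QuantumManyBody.PeriodicBoseGasJastrow
import Literature.MathematicalPhysics.QuantumManyBody.PeriodicBoseGasScattering

/-!
# Route `BECFisherTransfer` — support `TrialDriftFisherBound` (stmt-AtomisticToContinuum-14306):
# the energy of the explicit LSSY–Dyson–Jastrow trial state

Helper file for `Summit.AtomisticToContinuum.BoseEinsteinCondensation.Theses.BECFisherTransfer.TrialDriftFisherBound`.
The named fact `LSSY2005_jastrowBound` (proved in `PeriodicBoseGasJastrow.lean`) only records the
consequence `E₀^per(N,L) ≤ …` of the product-state computation [LSSY2005, Thm. 2.2, proof,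
(2.19)–(2.31)]; the item `TrialDriftFisherBound` needs the bound for the *trial state itself*
(`IsPairProfile.trialState`, the normalised `∏_{i<j} φ^per(xᵢ - xⱼ)`), because the relative Fisher
information of that explicit state with respect to the ground state is what is estimated. This file
re-runs the last (bookkeeping) step of the proof of `LSSY2005_jastrowBound_holds` with the
conclusion kept on the trial state (`periodicEnergy_trialState_le`), and then specialises it to the
Dyson profile of `LSSY2005_dysonProfile_holds` at cut-off `b/4`, `b = (4πρ₁/3)^{-1/3}`, with the
slack `ε = (a/b) · 8πa/(1 - 4a/b)` (instead of `ε → 0`, which is not available for a fixed state):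
`⟨Φ, HΦ⟩ ≤ (1 + a/b) · 4πρ₁ a (1 + 12 a/b) N` (`exists_jastrow_periodicEnergy_le`).

References: [LSSY2005] Lieb–Seiringer–Solovej–Yngvason, *The Mathematics of the Bose Gas and its
Condensation* (2005), Thm. 2.2 and its proof (2.15)–(2.33); [Dyson1957].
-/

noncomputable section

open MeasureTheory Filter Set Finset
open scoped ENNReal NNReal Topology BigOperators

namespace Summit.AtomisticToContinuum.BoseEinsteinCondensation.Theorems

open Literature.MathematicalPhysics.QuantumManyBody.BoseGas

namespace TrialDriftFisher

/-- **Energy of the Jastrow trial state** (LSSY 2005, proof of Thm. 2.2, (2.19)–(2.31), with the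
conclusion kept on the explicit normalised product state `Ψ/‖Ψ‖`, `Ψ = ∏_{i<j} φ^per(xᵢ - xⱼ)`):
for a pair profile `φ` with cut-off `b`, `0 < 2b < L`, `N ≥ 2`, and bounds `E₁ ≤ E`, `I ≤ I'`,
`K ≤ K'` with `(N-1)I' < L³`,
`⟨Ψ,HΨ⟩/⟨Ψ,Ψ⟩ ≤ N(N-1)/2 · E/(L³-(N-1)I') + N(N-1)(N-2) K'²/(L³-(N-1)I')²`.
The proof is that of `LSSY2005_jastrowBound_holds` verbatim, minus its final appeal to the
variational principle. [cite: LSSY2005, Thm. 2.2, proof, (2.19)–(2.31); Dyson1957] -/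
theorem periodicEnergy_trialState_le {v : ℝ → ℝ≥0∞} (hv : Measurable v) {N : ℕ} {L b : ℝ}
    (hN : 2 ≤ N) (hL : 0 < L) (hbL : 2 * b < L) {φ : Space → ℝ} (hφ : IsPairProfile b φ)
    {E I K : ℝ} (hE0 : 0 ≤ E) (hI0 : 0 ≤ I) (hK0 : 0 ≤ K)
    (hE : profileEnergy v φ ≤ ENNReal.ofReal E) (hI : profileDefect φ ≤ ENNReal.ofReal I)
    (hK : profileK φ ≤ ENNReal.ofReal K) (hNI : ((N : ℝ) - 1) * I < L ^ 3) :
    periodicEnergy v (hφ.trialState hL hbL (hφ.jastrowNormR_pos hL hbL hI0 hI hNI univ)) ≤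
      ENNReal.ofReal
        (N * ((N : ℝ) - 1) / 2 * E / (L ^ 3 - ((N : ℝ) - 1) * I) +
          N * ((N : ℝ) - 1) * ((N : ℝ) - 2) * K ^ 2 / (L ^ 3 - ((N : ℝ) - 1) * I) ^ 2) := by
  classical
  -- adapted from Literature/MathematicalPhysics/QuantumManyBody/PeriodicBoseGasJastrow.lean
  -- (`LSSY2005_jastrowBound_holds`)
  have hN1 : 1 ≤ N := by omega
  have hL3 : 0 < L ^ 3 := by positivity
  have hden : 0 < L ^ 3 - ((N : ℝ) - 1) * I := by linarith
  set D : ℝ := L ^ 3 / (L ^ 3 - ((N : ℝ) - 1) * I) with hD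
  have hD0 : 0 < D := div_pos hL3 hden
  set ν := jastrowNormR L φ (univ : Finset (Fin N)) with hν
  have hν0 : 0 < ν := hφ.jastrowNormR_pos hL hbL hI0 hI hNI univ
  -- norms of the states with one or two particles eliminated
  have hn1 : ∀ k : Fin N, jastrowNormSq L φ (univ.erase k) ≤ ENNReal.ofReal (D * ν) := by
    intro k
    rw [← hφ.ofReal_jastrowNormR]
    exact ENNReal.ofReal_le_ofReal (hφ.jastrowNormR_erase_le' hL hbL hI0 hI hNI univ (mem_univ k))
  have hn2 : ∀ i j : Fin N, j ≠ i →
      jastrowNormSq L φ ((univ.erase i).erase j) ≤ ENNReal.ofReal (D ^ 2 * ν) := by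
    intro i j hji
    rw [← hφ.ofReal_jastrowNormR]
    refine ENNReal.ofReal_le_ofReal ?_
    have h1 := hφ.jastrowNormR_erase_le' hL hbL hI0 hI hNI (univ.erase i)
      (mem_erase.mpr ⟨hji, mem_univ j⟩)
    have h2 := hφ.jastrowNormR_erase_le' hL hbL hI0 hI hNI univ (mem_univ i)
    calc jastrowNormR L φ ((univ.erase i).erase j) ≤ D * jastrowNormR L φ (univ.erase i) := h1
      _ ≤ D * (D * ν) := mul_le_mul_of_nonneg_left h2 hD0.le
      _ = D ^ 2 * ν := by ring
  -- the one-body integrals of the profile, as real numbers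
  set G := ∫⁻ x, gradSq φ x with hG
  set P := ∫⁻ x, v ‖x‖ * ENNReal.ofReal (φ x ^ 2) with hP
  have hGP : 2 * G + P = profileEnergy v φ := (profileEnergy_eq hφ.contDiff).symm
  have hGP' : 2 * G + P ≤ ENNReal.ofReal E := hGP ▸ hE
  have hGtop : G ≠ ⊤ := by
    refine ne_top_of_le_ne_top ENNReal.ofReal_ne_top ((le_trans ?_ le_self_add).trans hGP')
    rw [two_mul]; exact le_self_add
  have hPtop : P ≠ ⊤ := ne_top_of_le_ne_top ENNReal.ofReal_ne_top (le_add_self.trans hGP')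
  have hKtop : profileK φ ≠ ⊤ := ne_top_of_le_ne_top ENNReal.ofReal_ne_top hK
  set g := G.toReal with hg
  set p := P.toReal with hp
  set κ := (profileK φ).toReal with hκ
  have hg0 : 0 ≤ g := ENNReal.toReal_nonneg
  have hp0 : 0 ≤ p := ENNReal.toReal_nonneg
  have hκ0 : 0 ≤ κ := ENNReal.toReal_nonneg
  have hGe : G = ENNReal.ofReal g := (ENNReal.ofReal_toReal hGtop).symm
  have hPe : P = ENNReal.ofReal p := (ENNReal.ofReal_toReal hPtop).symm
  have hKe : profileK φ = ENNReal.ofReal κ := (ENNReal.ofReal_toReal hKtop).symm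
  have hgp : 2 * g + p ≤ E := by
    have h2G : (2 * G) ≠ ⊤ := ENNReal.mul_ne_top ENNReal.ofNat_ne_top hGtop
    have := ENNReal.toReal_le_of_le_ofReal hE0 hGP'
    rwa [ENNReal.toReal_add h2G hPtop, ENNReal.toReal_mul, ENNReal.toReal_ofNat] at this
  have hκK : κ ≤ K := ENNReal.toReal_le_of_le_ofReal hK0 hK
  have hL3e : (ENNReal.ofReal L ^ 3)⁻¹ = ENNReal.ofReal ((L ^ 3)⁻¹) := by
    rw [← ENNReal.ofReal_pow hL.le, ENNReal.ofReal_inv_of_pos hL3]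
  have hL3i : 0 ≤ (L ^ 3)⁻¹ := inv_nonneg.mpr hL3.le
  -- Step 1: the three families of terms, each bounded by a real number
  have hT1 : ∀ k : Fin N, ∀ l ∈ univ.erase k,
      (ENNReal.ofReal L ^ 3)⁻¹ * G * jastrowNormSq L φ (univ.erase k) ≤
        ENNReal.ofReal ((L ^ 3)⁻¹ * g * (D * ν)) := by
    intro k l _
    rw [hL3e, hGe, ← ENNReal.ofReal_mul hL3i, ENNReal.ofReal_mul (mul_nonneg hL3i hg0)]
    exact mul_le_mul' le_rfl (hn1 k)
  have hT2 : ∀ k : Fin N, ∀ i ∈ univ.erase k, ∀ j ∈ (univ.erase k).erase i,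
      (ENNReal.ofReal L ^ 3)⁻¹ * profileK φ * ((ENNReal.ofReal L ^ 3)⁻¹ * profileK φ *
          jastrowNormSq L φ ((univ.erase i).erase j)) ≤
        ENNReal.ofReal ((L ^ 3)⁻¹ * κ * ((L ^ 3)⁻¹ * κ * (D ^ 2 * ν))) := by
    intro k i _ j hj
    have hji : j ≠ i := ne_of_mem_erase hj
    rw [hL3e, hKe, ← ENNReal.ofReal_mul hL3i,
      ENNReal.ofReal_mul (mul_nonneg hL3i hκ0), ENNReal.ofReal_mul (mul_nonneg hL3i hκ0)]
    exact mul_le_mul' le_rfl (mul_le_mul' le_rfl (hn2 i j hji))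
  have hT3 : ∀ i : Fin N, ∀ j ∈ univ.filter (i < ·),
      (ENNReal.ofReal L ^ 3)⁻¹ * P * jastrowNormSq L φ (univ.erase i) ≤
        ENNReal.ofReal ((L ^ 3)⁻¹ * p * (D * ν)) := by
    intro i j _
    rw [hL3e, hPe, ← ENNReal.ofReal_mul hL3i, ENNReal.ofReal_mul (mul_nonneg hL3i hp0)]
    exact mul_le_mul' le_rfl (hn1 i)
  -- Step 2: sum them
  have hr1 : 0 ≤ (L ^ 3)⁻¹ * g * (D * ν) := by positivity
  have hr2 : 0 ≤ (L ^ 3)⁻¹ * κ * ((L ^ 3)⁻¹ * κ * (D ^ 2 * ν)) := by positivity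
  have hr3 : 0 ≤ (L ^ 3)⁻¹ * p * (D * ν) := by positivity
  have hN2 : (2 : ℝ) ≤ N := by exact_mod_cast hN
  have hNNr : 0 ≤ (N : ℝ) * ((N : ℝ) - 1) := mul_nonneg (Nat.cast_nonneg _) (by linarith)
  have hNNNr : 0 ≤ (N : ℝ) * ((N : ℝ) - 1) * ((N : ℝ) - 2) := mul_nonneg hNNr (by linarith)
  have hNN1 : ((N : ℝ≥0∞) * ((N - 1 : ℕ) : ℝ≥0∞)) = ENNReal.ofReal ((N : ℝ) * ((N : ℝ) - 1)) := by
    rw [← ENNReal.ofReal_natCast, ← ENNReal.ofReal_natCast, Nat.cast_sub hN1, Nat.cast_one,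
      ← ENNReal.ofReal_mul (Nat.cast_nonneg _)]
  have hNN2 : ((N : ℝ≥0∞) * ((N - 1 : ℕ) : ℝ≥0∞) * ((N - 2 : ℕ) : ℝ≥0∞)) =
      ENNReal.ofReal ((N : ℝ) * ((N : ℝ) - 1) * ((N : ℝ) - 2)) := by
    rw [hNN1, ← ENNReal.ofReal_natCast, Nat.cast_sub hN, Nat.cast_ofNat,
      ← ENNReal.ofReal_mul hNNr]
  have hkin : ∫⁻ X in cellN N L, kineticDensity (jastrowC L φ) X ≤
      ENNReal.ofReal ((N : ℝ) * ((N : ℝ) - 1) * ((L ^ 3)⁻¹ * g * (D * ν)) +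
        (N : ℝ) * ((N : ℝ) - 1) * ((N : ℝ) - 2) *
          ((L ^ 3)⁻¹ * κ * ((L ^ 3)⁻¹ * κ * (D ^ 2 * ν)))) := by
    refine (hφ.lintegral_kinetic_le hL hbL).trans ?_
    rw [ENNReal.ofReal_add (mul_nonneg hNNr hr1) (mul_nonneg hNNNr hr2)]
    refine add_le_add ?_ ?_
    · calc _ ≤ ∑ k : Fin N, ∑ _l ∈ univ.erase k, ENNReal.ofReal ((L ^ 3)⁻¹ * g * (D * ν)) :=
            sum_le_sum fun k _ => sum_le_sum fun l hl => hT1 k l hl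
        _ = _ := by rw [sum_erase_const, hNN1, ← ENNReal.ofReal_mul hNNr]
    · calc _ ≤ ∑ k : Fin N, ∑ i ∈ univ.erase k, ∑ _j ∈ (univ.erase k).erase i,
            ENNReal.ofReal ((L ^ 3)⁻¹ * κ * ((L ^ 3)⁻¹ * κ * (D ^ 2 * ν))) :=
            sum_le_sum fun k _ => sum_le_sum fun i hi => sum_le_sum fun j hj => hT2 k i hi j hj
        _ = _ := by rw [sum_erase_erase_const, hNN2, ← ENNReal.ofReal_mul hNNNr]
  have hpot : ∫⁻ X in cellN N L, periodicInteraction v L X * ENNReal.ofReal (jastrow L φ univ X ^ 2) ≤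
      ENNReal.ofReal ((N : ℝ) * ((N : ℝ) - 1) / 2 * ((L ^ 3)⁻¹ * p * (D * ν))) := by
    refine (hφ.lintegral_potential_le hL hbL hv).trans ?_
    calc _ ≤ ∑ i : Fin N, ∑ _j ∈ univ.filter (i < ·), ENNReal.ofReal ((L ^ 3)⁻¹ * p * (D * ν)) :=
          sum_le_sum fun i _ => sum_le_sum fun j hj => hT3 i j hj
      _ = _ := by rw [sum_filter_lt_const hN1, ← ENNReal.ofReal_mul (div_nonneg hNNr zero_le_two)]
  -- Step 3: the energy of the normalised trial state
  set A : ℝ := (N : ℝ) * ((N : ℝ) - 1) * ((L ^ 3)⁻¹ * g * (D * ν)) +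
      (N : ℝ) * ((N : ℝ) - 1) * ((N : ℝ) - 2) * ((L ^ 3)⁻¹ * κ * ((L ^ 3)⁻¹ * κ * (D ^ 2 * ν))) +
      (N : ℝ) * ((N : ℝ) - 1) / 2 * ((L ^ 3)⁻¹ * p * (D * ν)) with hA
  have hA1 : 0 ≤ (N : ℝ) * ((N : ℝ) - 1) * ((L ^ 3)⁻¹ * g * (D * ν)) +
      (N : ℝ) * ((N : ℝ) - 1) * ((N : ℝ) - 2) * ((L ^ 3)⁻¹ * κ * ((L ^ 3)⁻¹ * κ * (D ^ 2 * ν))) :=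
    add_nonneg (mul_nonneg hNNr hr1) (mul_nonneg hNNNr hr2)
  have hA2 : 0 ≤ (N : ℝ) * ((N : ℝ) - 1) / 2 * ((L ^ 3)⁻¹ * p * (D * ν)) :=
    mul_nonneg (div_nonneg hNNr zero_le_two) hr3
  have htot : periodicEnergy v (hφ.trialState hL hbL hν0) ≤ ENNReal.ofReal (ν⁻¹ * A) := by
    rw [hφ.periodicEnergy_trialState hL hbL hν0 v, ENNReal.ofReal_mul (inv_nonneg.mpr hν0.le)]
    refine mul_le_mul' le_rfl ?_
    rw [lintegral_add_left (kineticDensity_measurable _), hA, ENNReal.ofReal_add hA1 hA2]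
    exact add_le_add hkin hpot
  -- Step 4: the algebra `ν⁻¹ A ≤ N(N-1)/2 · E/(L³-(N-1)I) + N(N-1)(N-2) K²/(L³-(N-1)I)²`
  have hB : ν⁻¹ * A = (N : ℝ) * ((N : ℝ) - 1) / 2 * (2 * g + p) / (L ^ 3 - ((N : ℝ) - 1) * I) +
      (N : ℝ) * ((N : ℝ) - 1) * ((N : ℝ) - 2) * κ ^ 2 / (L ^ 3 - ((N : ℝ) - 1) * I) ^ 2 := by
    rw [hA, hD]
    field_simp
    ring
  have hfin : ν⁻¹ * A ≤ (N : ℝ) * ((N : ℝ) - 1) / 2 * E / (L ^ 3 - ((N : ℝ) - 1) * I) +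
      (N : ℝ) * ((N : ℝ) - 1) * ((N : ℝ) - 2) * K ^ 2 / (L ^ 3 - ((N : ℝ) - 1) * I) ^ 2 := by
    rw [hB]
    refine add_le_add ?_ ?_
    · refine div_le_div_of_nonneg_right ?_ hden.le
      exact mul_le_mul_of_nonneg_left hgp (by positivity)
    · refine div_le_div_of_nonneg_right ?_ (by positivity)
      exact mul_le_mul_of_nonneg_left (pow_le_pow_left₀ hκ0 hκK 2) (by nlinarith)
  exact htot.trans (ENNReal.ofReal_le_ofReal hfin)

/-- The Jastrow trial state is a positive multiple of the product `∏_{i<j} φ^per(xᵢ - xⱼ)`: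
`Φ(X) = c · jastrow L φ univ X` with `c = ‖Ψ‖⁻¹ > 0`. [folklore] -/
theorem trialState_apply {N : ℕ} {L b : ℝ} {φ : Space → ℝ} (hφ : IsPairProfile b φ) (hL : 0 < L)
    (hbL : 2 * b < L) (hν : 0 < jastrowNormR L φ (univ : Finset (Fin N))) (X : Config N) :
    (hφ.trialState hL hbL hν).ψ X =
      (((Real.sqrt (jastrowNormR L φ (univ : Finset (Fin N))))⁻¹ * jastrow L φ univ X : ℝ) : ℂ) := by
  show (((jastrow L φ univ X * (Real.sqrt (jastrowNormR L φ (univ : Finset (Fin N))))⁻¹ : ℝ)) : ℂ)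
    = _
  rw [mul_comm]

/-- Elementary: for `0 ≤ x` and `0 ≤ S, T`, `(1 + x) S + T ≤ (1 + x) (S + T)`. [folklore] -/
theorem one_add_mul_add_le {x S T : ℝ} (hx : 0 ≤ x) (hT : 0 ≤ T) :
    (1 + x) * S + T ≤ (1 + x) * (S + T) := by
  nlinarith

/-- **Energy of the LSSY trial state at the Dyson profile** (LSSY 2005, Thm. 2.2, for the explicit
state rather than for `E₀`). Let `v ≥ 0` be measurable of finite range `R₀` with
`0 < a = scatteringLength v < ∞`, and let `b₀(v)` be the threshold of `LSSY2005_dysonProfile`.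
For `N ≥ 2`, `L > 0`, `ρ₁ = (N-1)/L³`, `b = (4πρ₁/3)^{-1/3}` and `a/b ≤ min (1/16) (a/(4 b₀))`
there is a normalised periodic trial state of Bijl–Dyson–Jastrow form
`Φ = c ∏_{i<j} φ^per(xᵢ - xⱼ)` (`φ` a pair profile of cut-off `b/4`, `c > 0`) with
`⟨Φ, HΦ⟩ ≤ (1 + a/b) · 4πρ₁ a (1 + 12 a/b) N` — the profile of App. C at cut-off `b/4` with energy
slack `ε = (a/b) · 8πa/(1 - 4a/b)`, the product-state bound `periodicEnergy_trialState_le`, and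
the optimisation `jastrow_optimisation` of `PeriodicBoseGasUpperBound.lean`.
[cite: LSSY2005, Thm. 2.2 (2.14), proof (2.15)–(2.33); Dyson1957] -/
theorem exists_jastrow_periodicEnergy_le {v : ℝ → ℝ≥0∞} {R₀ : ℝ} (hv : Measurable v)
    (hR : ∀ r, R₀ < r → v r = 0) (ha : scatteringLength v ≠ ⊤) (ha0 : 0 < scatteringLength v) :
    ∃ b₀ : ℝ, (scatteringLength v).toReal < b₀ ∧
      ∀ (N : ℕ) (L : ℝ), 2 ≤ N → 0 < L →
        let a := (scatteringLength v).toReal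
        let ρ₁ := ((N : ℝ) - 1) / L ^ 3
        let b := (4 * Real.pi * ρ₁ / 3) ^ (-(1 : ℝ) / 3)
        a / b ≤ min (1 / 16) (a / (4 * b₀)) →
        ∃ (Φ : PeriodicTrialState N L) (β c : ℝ) (φ : Space → ℝ), IsPairProfile β φ ∧ 0 < c ∧
          (∀ X, Φ.ψ X = ((c * jastrow L φ Finset.univ X : ℝ) : ℂ)) ∧
          periodicEnergy v Φ ≤ ENNReal.ofReal
            ((1 + a / b) * (4 * Real.pi * ρ₁ * a * (1 + 12 * (a / b)) * N)) := by
  -- adapted from `LSSY2005_upperBound_periodic_of_layers` (PeriodicBoseGasUpperBound.lean)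
  obtain ⟨b₀, hab₀, hA'⟩ := LSSY2005_dysonProfile_holds v R₀ hv hR ha ha0
  refine ⟨b₀, hab₀, fun N L hN hL => ?_⟩
  dsimp only
  intro hab
  set a := (scatteringLength v).toReal with ha_def
  have ha0' : 0 < a := ENNReal.toReal_pos ha0.ne' ha
  have hb₀ : 0 < b₀ := ha0'.trans hab₀
  set b : ℝ := (4 * Real.pi * (((N : ℝ) - 1) / L ^ 3) / 3) ^ (-(1 : ℝ) / 3) with hb_def
  have hN' : (2 : ℝ) ≤ N := by exact_mod_cast hN
  have hn₁ : (1 : ℝ) ≤ (N : ℝ) - 1 := by linarith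
  have ht : 0 < 4 * Real.pi * (((N : ℝ) - 1) / L ^ 3) / 3 := by positivity
  have hb0 : 0 < b := Real.rpow_pos_of_pos ht _
  have hb3 : 4 * Real.pi * ((N : ℝ) - 1) * b ^ 3 = 3 * L ^ 3 := by
    have h3 : b ^ 3 = (4 * Real.pi * (((N : ℝ) - 1) / L ^ 3) / 3)⁻¹ := by
      rw [hb_def, ← Real.rpow_natCast, ← Real.rpow_mul ht.le]
      norm_num
      rw [Real.rpow_neg_one, inv_div]
    rw [h3]
    field_simp
  have hx : a / b ≤ 1 / 16 := hab.trans (min_le_left _ _)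
  have hx0 : 0 < a / b := div_pos ha0' hb0
  have hb4 : b₀ ≤ b / 4 := by
    have h := hab.trans (min_le_right _ _)
    rw [div_le_div_iff_of_pos_left ha0' hb0 (by positivity)] at h
    linarith
  have hbL : b < L := by
    refine lt_of_pow_lt_pow_left₀ 3 hL.le ?_
    have hL3 : 0 < L ^ 3 := by positivity
    have hb3' : 0 < b ^ 3 := by positivity
    have h1 : b ^ 3 ≤ ((N : ℝ) - 1) * b ^ 3 := le_mul_of_one_le_left hb3'.le hn₁
    have h2 : 4 * Real.pi * b ^ 3 ≤ 4 * Real.pi * (((N : ℝ) - 1) * b ^ 3) :=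
      mul_le_mul_of_nonneg_left h1 (by positivity)
    have h3 : 4 * 2 * b ^ 3 ≤ 4 * Real.pi * b ^ 3 := by
      have := Real.two_le_pi
      gcongr
    nlinarith
  have hβL : 2 * (b / 4) < L := by linarith
  have hI : ((N : ℝ) - 1) * (16 * Real.pi * a * (b / 4) ^ 2) < L ^ 3 := by
    have h' : ((N : ℝ) - 1) * (16 * Real.pi * a * (b / 4) ^ 2) =
        4 * Real.pi * ((N : ℝ) - 1) * b ^ 3 * (a / b) / 4 := by
      field_simp
      ring
    rw [h', hb3]
    have hL3 : 0 < L ^ 3 := by positivity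
    nlinarith
  -- the profile at cut-off `β = b/4` with slack `ε = (a/b) E₁⁰`
  set E₀ : ℝ := 8 * Real.pi * a / (1 - a / (b / 4)) with hE₀
  have haβ1 : a / (b / 4) < 1 := by
    rw [div_lt_one (by positivity)]
    have : a / b * b = a := by field_simp
    nlinarith
  have hE₀0 : 0 < E₀ := div_pos (by positivity) (by linarith)
  have hε : 0 < a / b * E₀ := mul_pos hx0 hE₀0
  obtain ⟨φ, hφ, hφE, hφI, hφK⟩ := hA' (b / 4) (a / b * E₀) hb4 hε
  have hI0 : (0 : ℝ) ≤ 16 * Real.pi * a * (b / 4) ^ 2 := by positivity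
  have hK0 : (0 : ℝ) ≤ 16 * Real.pi * a * (b / 4) := by positivity
  have hE0 : (0 : ℝ) ≤ E₀ + a / b * E₀ := by positivity
  have hν := hφ.jastrowNormR_pos hL hβL hI0 hφI hI (univ : Finset (Fin N))
  refine ⟨hφ.trialState hL hβL hν, b / 4, (Real.sqrt (jastrowNormR L φ (univ : Finset (Fin N))))⁻¹,
    φ, hφ, by positivity, fun X => trialState_apply hφ hL hβL hν X, ?_⟩
  refine (periodicEnergy_trialState_le hv hN hL hβL hφ hE0 hI0 hK0 hφE hφI hφK hI).trans
    (ENNReal.ofReal_le_ofReal ?_)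
  have hopt := jastrow_optimisation hN' ha0' hb0 hx hb3
  have hden : 0 < L ^ 3 - ((N : ℝ) - 1) * (16 * Real.pi * a * (b / 4) ^ 2) := by linarith
  have hT0 : 0 ≤ (N : ℝ) * ((N : ℝ) - 1) * ((N : ℝ) - 2) * (16 * Real.pi * a * (b / 4)) ^ 2 /
      (L ^ 3 - ((N : ℝ) - 1) * (16 * Real.pi * a * (b / 4) ^ 2)) ^ 2 := by
    have : 0 ≤ (N : ℝ) * ((N : ℝ) - 1) * ((N : ℝ) - 2) :=
      mul_nonneg (mul_nonneg (Nat.cast_nonneg _) (by linarith)) (by linarith)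
    positivity
  have hsplit : (N : ℝ) * ((N : ℝ) - 1) / 2 * (E₀ + a / b * E₀) /
        (L ^ 3 - ((N : ℝ) - 1) * (16 * Real.pi * a * (b / 4) ^ 2)) =
      (1 + a / b) * ((N : ℝ) * ((N : ℝ) - 1) / 2 * E₀ /
        (L ^ 3 - ((N : ℝ) - 1) * (16 * Real.pi * a * (b / 4) ^ 2))) := by
    field_simp
  rw [hsplit]
  refine (one_add_mul_add_le hx0.le hT0).trans ?_
  exact mul_le_mul_of_nonneg_left hopt (by positivity)

end TrialDriftFisher

end Summit.AtomisticToContinuum.BoseEinsteinCondensation.Theorems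

end
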